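import Mathlib

/-!
# Route `SymPencil` — inner rank of the `2 | 2` row split of `per_4`, PEELED case: AVOIDING THE
# EXCEPTIONAL RATIOS of the chord chart along a monomial family (`--supports`
# stmt-ValiantsHypothesis-5674 `SdcSuperquadratic`; (8,8) column, memo
# `NOTE-p8g15-5674-R2-two-pencil.md` §9.7 "one small a₀-existence lemma"; rung currency only)

The chord chart `…TwoPencilChordAQ.frames_of_chordA_of_indep` (p8 g15) carries ten side
conditions on the pencil ratio `r` (`r ≠ 0`, `r + 1 ≠ 0`, `3r + 4 ≠ 0`, a cubic, three quadratics,
a quartic, `r − 3 ≠ 0`, `r² − 3 ≠ 0`).  In the residual «two single-entry columns» classes of the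
(8,8,11) coverage programme the ratio realised by the one-parameter frame vector
`a₀ = 𝟙 + (s − 1)e_j` is a monomial `r(s) = c·s^e` (`c ≠ 0`, `e ∈ {1, 2}`).  **Lemma**
(`exists_good_ratio`): over a field of characteristic zero some `s ≠ 0` makes `c·s^e` pass all ten
conditions — each condition is the non-vanishing at `s` of a NON-ZERO polynomial (the exception
polynomial composed with `c X^e` has the exception's non-zero constant term as its value at `0`),
and an infinite field avoids the finitely many roots of their product (`exists_eval_ne_zero`).

Honest framing: a parameter-existence lemma; no frame, chart or cell here; the window
`28 ≤ sdc(per₄) ≤ 29` of record, the crux `SdcSuperquadratic` and `VP ≠ VNP` are untouched.  No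
definitions, no named facts. [folklore]
-/

noncomputable section

-- single-conjunct layout: Sub = Summit, duplicated namespace component intended
set_option linter.dupNamespace false

namespace Summit.ValiantsHypothesis.ValiantsHypothesis.Theorems.SymPencilPerFourPeeledTwoPencilAvoid

open Polynomial

universe u

variable {K : Type u} [Field K]

/-- A non-zero polynomial over an infinite field has a non-root. [folklore] -/
theorem exists_eval_ne_zero [Infinite K] (F : K[X]) (hF : F ≠ 0) : ∃ s : K, F.eval s ≠ 0 := by
  classical
  obtain ⟨s, hs⟩ := Infinite.exists_notMem_finset F.roots.toFinset
  exact ⟨s, fun h => hs (Multiset.mem_toFinset.mpr ((Polynomial.mem_roots hF).mpr h))⟩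

/-- **Avoiding the ten exceptional ratios of the chord chart along `r = c·s^e`.** [folklore] -/
theorem exists_good_ratio [CharZero K] (c : K) (hc : c ≠ 0) (e : ℕ) (he : e ≠ 0) :
    ∃ s : K, s ≠ 0 ∧ c * s ^ e ≠ 0 ∧ c * s ^ e + 1 ≠ 0 ∧ 3 * (c * s ^ e) + 4 ≠ 0 ∧
      (c * s ^ e) ^ 3 - 8 * (c * s ^ e) ^ 2 - 20 * (c * s ^ e) - 12 ≠ 0 ∧
      (c * s ^ e) ^ 2 + 4 * (c * s ^ e) + 1 ≠ 0 ∧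
      4 * (c * s ^ e) ^ 2 + 7 * (c * s ^ e) + 4 ≠ 0 ∧
      (c * s ^ e) ^ 2 + (c * s ^ e) + 1 ≠ 0 ∧
      (c * s ^ e) ^ 4 - 7 * (c * s ^ e) ^ 3 - 15 * (c * s ^ e) ^ 2 - 7 * (c * s ^ e) + 1 ≠ 0 ∧
      c * s ^ e - 3 ≠ 0 ∧ (c * s ^ e) ^ 2 - 3 ≠ 0 := by
  classical
  -- the substitution polynomial `g = c X^e`
  obtain ⟨g, hg⟩ : ∃ g : K[X], g = C c * X ^ e := ⟨_, rfl⟩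
  have hg0 : g.eval 0 = 0 := by simp [hg, zero_pow he]
  have hgs : ∀ s : K, g.eval s = c * s ^ e := fun s => by simp [hg]
  -- an exception polynomial with non-zero constant term stays non-zero after the substitution
  have hne : ∀ q : K[X], q.eval 0 ≠ 0 → q.comp g ≠ 0 := by
    intro q hq h
    have h' := congrArg (Polynomial.eval (0 : K)) h
    rw [eval_comp, hg0, eval_zero] at h'
    exact hq h'
  -- the nine exception polynomials (besides `r` itself)
  obtain ⟨q₁, hq₁⟩ : ∃ q : K[X], q = X + 1 := ⟨_, rfl⟩
  obtain ⟨q₂, hq₂⟩ : ∃ q : K[X], q = C 3 * X + C 4 := ⟨_, rfl⟩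
  obtain ⟨q₃, hq₃⟩ : ∃ q : K[X], q = X ^ 3 - C 8 * X ^ 2 - C 20 * X - C 12 := ⟨_, rfl⟩
  obtain ⟨q₄, hq₄⟩ : ∃ q : K[X], q = X ^ 2 + C 4 * X + 1 := ⟨_, rfl⟩
  obtain ⟨q₅, hq₅⟩ : ∃ q : K[X], q = C 4 * X ^ 2 + C 7 * X + C 4 := ⟨_, rfl⟩
  obtain ⟨q₆, hq₆⟩ : ∃ q : K[X], q = X ^ 2 + X + 1 := ⟨_, rfl⟩
  obtain ⟨q₇, hq₇⟩ : ∃ q : K[X], q = X ^ 4 - C 7 * X ^ 3 - C 15 * X ^ 2 - C 7 * X + 1 :=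
    ⟨_, rfl⟩
  obtain ⟨q₈, hq₈⟩ : ∃ q : K[X], q = X - C 3 := ⟨_, rfl⟩
  obtain ⟨q₉, hq₉⟩ : ∃ q : K[X], q = X ^ 2 - C 3 := ⟨_, rfl⟩
  have n₁ : q₁.comp g ≠ 0 := hne q₁ (by rw [hq₁]; simp)
  have n₂ : q₂.comp g ≠ 0 := hne q₂ (by rw [hq₂]; simp)
  have n₃ : q₃.comp g ≠ 0 := hne q₃ (by rw [hq₃]; simp)
  have n₄ : q₄.comp g ≠ 0 := hne q₄ (by rw [hq₄]; simp)
  have n₅ : q₅.comp g ≠ 0 := hne q₅ (by rw [hq₅]; simp)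
  have n₆ : q₆.comp g ≠ 0 := hne q₆ (by rw [hq₆]; simp)
  have n₇ : q₇.comp g ≠ 0 := hne q₇ (by rw [hq₇]; simp)
  have n₈ : q₈.comp g ≠ 0 := hne q₈ (by rw [hq₈]; simp)
  have n₉ : q₉.comp g ≠ 0 := hne q₉ (by rw [hq₉]; simp)
  have hF : X * q₁.comp g * q₂.comp g * q₃.comp g * q₄.comp g * q₅.comp g * q₆.comp g *
      q₇.comp g * q₈.comp g * q₉.comp g ≠ 0 :=
    mul_ne_zero (mul_ne_zero (mul_ne_zero (mul_ne_zero (mul_ne_zero (mul_ne_zero (mul_ne_zero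
      (mul_ne_zero (mul_ne_zero X_ne_zero n₁) n₂) n₃) n₄) n₅) n₆) n₇) n₈) n₉
  obtain ⟨s, hs⟩ := exists_eval_ne_zero _ hF
  simp only [eval_mul, mul_ne_zero_iff, eval_X, eval_comp, hgs] at hs
  obtain ⟨⟨⟨⟨⟨⟨⟨⟨⟨hs0, e₁⟩, e₂⟩, e₃⟩, e₄⟩, e₅⟩, e₆⟩, e₇⟩, e₈⟩, e₉⟩ := hs
  rw [hq₁] at e₁; rw [hq₂] at e₂; rw [hq₃] at e₃; rw [hq₄] at e₄; rw [hq₅] at e₅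
  rw [hq₆] at e₆; rw [hq₇] at e₇; rw [hq₈] at e₈; rw [hq₉] at e₉
  simp only [eval_add, eval_sub, eval_mul, eval_pow, eval_X, eval_C, eval_one] at e₁ e₂ e₃ e₄ e₅
  simp only [eval_add, eval_sub, eval_mul, eval_pow, eval_X, eval_C, eval_one] at e₆ e₇ e₈ e₉
  exact ⟨s, hs0, mul_ne_zero hc (pow_ne_zero _ hs0), e₁, e₂, e₃, e₄, e₅, e₆, e₇, e₈, e₉⟩

end Summit.ValiantsHypothesis.ValiantsHypothesis.Theorems.SymPencilPerFourPeeledTwoPencilAvoid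

end
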